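import Summits.QuantumFields.YangMills.Theorems.AllWindowsColdBoxBoxHighLineEventInsideFPCore

/-!
# `EventInsideFP` (U5-BLOCKERS L4 «CubicCutInsideFP», generalised) — the T-S5.6 domination trick for an ARBITRARY event inside the small field
# (planner ym-idea-2 g18, `Cruxes/BoxWindowHighSU2213/U5-BLOCKERS.md` §2 L4 «the same tail INSIDE the FP weight by the T-S5.6 domination trick»;
# LINE-20 U5 ⟨stmt-QuantumFields-24336⟩ `stub_landauThirdOrder`, LINE-19 S5 ⟨24004⟩/⟨24335⟩; objects from ✓`…Step2Defs` / ✓`…Step2Wick` BY NAME)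

Width seat `ym-line-sfw-p2-w4` (prover-ym-line-sfw-p2-w4-g29-0), continuing its lineage's T-S5.6 files (w4 g27 ✓`…SmallFieldInsideFPCore` /
✓`…SmallFieldInsideFP`, w4 g28 ✓`…SmallFieldInsideFPByName`; cores in ✓`…EventInsideFPCore`).  T-S5.6 says that inside the Faddeev–Popov chart weight
`w_J = fpChartWeight β H r` the complement of the small-field box `D = smallField H s` is exponentially rare.  The U5 lift L4 wants the same transfer
for a further cut `D′ = D ∖ A` by an arbitrary measurable «bad event» `A` (the cubic cut `A = {|V₃| > λ}`, or any other): a Gaussian bound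
`P_{β′}(A) ≤ p ≤ 1/4` for the chart Gaussians `β′ ∈ [β/2, 2β]` becomes

  ★★ **`SmallFieldFP.eventInsideFP`**: `∫_{D ∩ A} w_J ≤ 2·e^{C·s·H⁵}·p·∫_{D ∖ A} w_J`
  (`H ≥ 1`, `β > 0`, `0 < s ≤ r`, `s·H² ≤ c₀`, `C(1+log H) ≤ βs²`), with the sharper reference set `smallField(s/2) ∖ A` in `eventInsideFP_half`
  and both at once (same constants) in `eventInsideFP_both`.

Proof = T-S5.6 verbatim at the small-field scale `s` (NOT at the support scale `π·r`: the event lives inside `D`): ✓`actionSandwich` (6a) at `t = s`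
gives the relative sandwich `ε = C₆⁺·s·H ≤ 1/2`; ✓`TiltSup.detRatio_of_ghostTaylor ghostTaylor` (6b) at `t = s` the determinant ratio `K = e^{C₇⁺·s·H⁵}`
against the base point `a = 0`; ✓`landauVarianceBounded` + ✓`ChartGauss.*` the Gaussian tails / masses / mass ratio `((1+ε)/(1−ε))^{3n/2} ≤ e^{6nε}`;
the cores and the arithmetic are ✓`…EventInsideFPCore`.  The bracket `e^{C·s·H⁵}`, `C = 2C₇⁺ + 216 + 1296C₆⁺ + 288C₃`, is the Gaussian-normaliser
ratio of the RELATIVE sandwich times the determinant ratio and the Haar factor `e^{n·s²}` (`n ≤ 216H⁴`); the exponent bookkeeping (`s = β^{−1/2+κ₃}`,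
`H ≍ β^θ`: `s·H⁵ = β^{5θ−1/2+κ₃}`) and the choice of `A`/`p` (e.g. w5 g23's polynomial-certificate Gaussian tails for `A = {λ ≤ |cubicVertex β H ·|}`)
are the U5 assembler's.

Everything proved; no definitions; standard axioms.  HONEST LABEL: a generic measure-comparison brick for the RECORDED, UNSTAFFED lift L4 of the next rung U5
(`stub_landauThirdOrder`, LINE-20) reusing STEP 2 of the XL stub S5 of a critic-PASSed DRAFT line; S5, U5, ⟨24004⟩ ⟨24335⟩ ⟨24336⟩ and the seat's own crux
⟨22884⟩ remain OPEN; no stub is closed by name, no crux, rung or summit is proved; **the Yang–Mills mass gap is NOT proved by this file.**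
-/

set_option autoImplicit false

open MeasureTheory Real Finset

namespace Summit.QuantumFields.YangMills.Theorems.AllWindowsColdBoxBoxHighLine

namespace SmallFieldFP

variable {H : ℕ}

/-! ## The packaged statement -/

/-- ★ **`EventInsideFP`, both reference sets at once** — the T-S5.6 domination trick for an arbitrary measurable event `A` inside the small field:
if the chart Gaussians `β′ ∈ [β/2, 2β]` give `A` probability `≤ p ≤ 1/4`, then (same constants `C`, `c₀`)
`∫_{smallField s ∩ A} w_J ≤ 2·e^{C·s·H⁵}·p·∫_{smallField(s/2) ∖ A} w_J` and `… ≤ 2·e^{C·s·H⁵}·p·∫_{smallField s ∖ A} w_J`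
(`w_J = fpChartWeight β H r`, `0 < s ≤ r`, `s·H² ≤ c₀`, `C(1+log H) ≤ βs²`).
Inputs by name: ✓`actionSandwich` (6a) and ✓`TiltSup.detRatio_of_ghostTaylor ghostTaylor` (6b) at level `s`, ✓`landauVarianceBounded`, ✓`ChartGauss.*`. -/
theorem eventInsideFP_both :
    ∃ C c₀ : ℝ, 0 < c₀ ∧ ∀ H : ℕ, 1 ≤ H → ∀ β r s : ℝ, 0 < β → 0 < s → s ≤ r → s * (H : ℝ) ^ 2 ≤ c₀ →
      C * (1 + Real.log H) ≤ β * s ^ 2 →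
      ∀ A : Set (LandauFree H → E3), MeasurableSet A → ∀ p : ℝ, p ≤ 1 / 4 →
        (∀ β' : ℝ, β / 2 ≤ β' → β' ≤ 2 * β → gaussAvg β' H (A.indicator fun _ => (1 : ℝ)) ≤ p) →
        (∫ a in smallField H s ∩ A, fpChartWeight β H r a ≤
          2 * Real.exp (C * s * (H : ℝ) ^ 5) * p * ∫ a in smallField H (s / 2) \ A, fpChartWeight β H r a) ∧
        (∫ a in smallField H s ∩ A, fpChartWeight β H r a ≤
          2 * Real.exp (C * s * (H : ℝ) ^ 5) * p * ∫ a in smallField H s \ A, fpChartWeight β H r a) := by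
  obtain ⟨C₆, c₆, hc₆, h6a⟩ := actionSandwich
  obtain ⟨C₇, c₇, hc₇, h6b⟩ := TiltSup.detRatio_of_ghostTaylor ghostTaylor
  obtain ⟨C₃', hC₃'⟩ := landauVarianceBounded
  -- positive versions of the constants
  set C₆p := max C₆ 0 with hC₆p
  set C₇p := max C₇ 0 with hC₇p
  set C₃ := max C₃' 1 with hC₃def
  have hC₆p0 : 0 ≤ C₆p := le_max_right _ _
  have hC₇p0 : 0 ≤ C₇p := le_max_right _ _
  have hC₃ : 1 ≤ C₃ := le_max_right _ _
  have hC₃pos : 0 < C₃ := by linarith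
  -- the constants of the statement
  set c₀ : ℝ := min (min c₆ c₇) (min (1 / (2 * C₆p + 1)) 1) with hc₀def
  set C : ℝ := 2 * C₇p + 216 + 1296 * C₆p + 288 * C₃ with hCdef
  have hC0 : 0 ≤ C := by rw [hCdef]; positivity
  have hc₀pos : 0 < c₀ := by
    rw [hc₀def]
    exact lt_min (lt_min hc₆ hc₇) (lt_min (by positivity) one_pos)
  have hc₀6 : c₀ ≤ c₆ := (min_le_left _ _).trans (min_le_left _ _)
  have hc₀7 : c₀ ≤ c₇ := (min_le_left _ _).trans (min_le_right _ _)
  have hc₀ε : c₀ ≤ 1 / (2 * C₆p + 1) := (min_le_right _ _).trans (min_le_left _ _)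
  have hc₀1 : c₀ ≤ 1 := (min_le_right _ _).trans (min_le_right _ _)
  refine ⟨C, c₀, hc₀pos, ?_⟩
  intro H hH β r s hβpos hs hsr hsH hCβ A hA p hp4 hgauss
  have hH' : (1 : ℝ) ≤ H := by exact_mod_cast hH
  have hlog : 0 ≤ Real.log H := Real.log_nonneg hH'
  have hH2 : (1 : ℝ) ≤ (H : ℝ) ^ 2 := one_le_pow₀ hH'
  have hHH : (H : ℝ) ≤ (H : ℝ) ^ 2 := le_self_pow₀ hH' two_ne_zero
  -- the basic geometry of the parameters
  have hr : 0 < r := lt_of_lt_of_le hs hsr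
  have hsc : s ≤ c₀ := le_trans (le_mul_of_one_le_right hs.le hH2) hsH
  have hs1 : s ≤ 1 := hsc.trans hc₀1
  have hsH1 : s * (H : ℝ) ≤ c₆ := by
    calc s * (H : ℝ) ≤ s * (H : ℝ) ^ 2 := mul_le_mul_of_nonneg_left hHH hs.le
      _ ≤ c₆ := hsH.trans hc₀6
  have hsH2 : s * (H : ℝ) ^ 2 ≤ c₇ := hsH.trans hc₀7
  have hvar : ∀ e : LandauFree H, (hodgeQ H)⁻¹ e e ≤ C₃ := fun e => (hC₃' H hH e).trans (le_max_left _ _)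
  -- the relative error `ε = C₆⁺ s H ≤ 1/2`
  set ε : ℝ := C₆p * s * H with hεdef
  have hε0 : 0 ≤ ε := by positivity
  have hεle : ε ≤ 1 / 2 := by
    have h1 : ε ≤ C₆p * c₀ := by
      calc ε = C₆p * (s * H) := by rw [hεdef]; ring
        _ ≤ C₆p * (s * (H : ℝ) ^ 2) := mul_le_mul_of_nonneg_left (mul_le_mul_of_nonneg_left hHH hs.le) hC₆p0
        _ ≤ C₆p * c₀ := mul_le_mul_of_nonneg_left hsH hC₆p0
    have h3 : c₀ * (2 * C₆p + 1) ≤ 1 := by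
      rw [← le_div_iff₀ (by positivity)]; exact hc₀ε
    have h4 : C₆p * c₀ = (c₀ * (2 * C₆p + 1) - c₀) / 2 := by ring
    rw [h4] at h1
    linarith only [h1, h3, hc₀pos]
  have hε1 : ε ≤ 1 := by linarith
  -- the action sandwich at level `s`
  have hsand : ∀ a : LandauFree H → E3, (∀ e, ‖a e‖ ≤ s) →
      |boxWilson H (edgeChart H a) + landauPhi H (edgeChart H a) - boxQuadForm H a| ≤ ε * boxQuadForm H a := by
    intro a ha
    have h := h6a H hH s hs.le hsH1 a ha
    have hQ := BoxQuadForm.boxQuadForm_nonneg hH a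
    refine h.trans ?_
    rw [hεdef]
    have : C₆ * s * H ≤ C₆p * s * H :=
      mul_le_mul_of_nonneg_right (mul_le_mul_of_nonneg_right (le_max_left _ _) hs.le) (Nat.cast_nonneg _)
    exact mul_le_mul_of_nonneg_right this hQ
  -- the determinant comparison at level `s`, against the base point `0`
  set K : ℝ := Real.exp (C₇p * s * (H : ℝ) ^ 5) with hKdef
  have hK : 0 < K := Real.exp_pos _
  set D₀ : ℝ := |(fpOperator H (edgeChart H 0)).det| with hD₀def
  have hD₀ : 0 ≤ D₀ := abs_nonneg _
  have h0mem : (0 : LandauFree H → E3) ∈ smallField H s := fun e => by simp [hs.le]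
  have hKle : Real.exp (C₇ * s * (H : ℝ) ^ 5) ≤ K :=
    Real.exp_le_exp.2 (mul_le_mul_of_nonneg_right (mul_le_mul_of_nonneg_right (le_max_left _ _) hs.le) (by positivity))
  have hdet : ∀ a : LandauFree H → E3, a ∈ smallField H s →
      |(fpOperator H (edgeChart H a)).det| ≤ K * D₀ ∧ D₀ ≤ K * |(fpOperator H (edgeChart H a)).det| := by
    intro a ha
    constructor
    · exact (h6b H hH _ hs.le hsH2 a 0 ha h0mem).trans (mul_le_mul_of_nonneg_right hKle hD₀)
    · exact (h6b H hH _ hs.le hsH2 0 a h0mem ha).trans (mul_le_mul_of_nonneg_right hKle (abs_nonneg _))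
  clear_value D₀
  clear h6a h6b hC₃'
  -- the two integral bounds
  have hU := setIntegral_inter_le (H := H) (s := s) hβpos le_rfl hεle hK.le hD₀ hsand (fun a ha => (hdet a ha).1) r hA
  have ht0 : 0 ≤ s / 2 := by linarith only [hs]
  have htr : s / 2 ≤ r := by linarith only [hs, hsr]
  have ht1 : s / 2 ≤ 1 := by linarith only [hs, hs1]
  have htT : s / 2 ≤ s := by linarith only [hs]
  have hL := le_setIntegral_smallField_diff hH hβpos hr ht0 htr ht1 htT hε0 hε1 hK hD₀ hsand hdet hA
  have hβp : 0 < β * (1 + ε) := mul_pos hβpos (by linarith only [hε0])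
  have hβm : 0 < β * (1 - ε) := mul_pos hβpos (by linarith only [hεle])
  -- the Gaussian inputs (all in raw form; the arithmetic is done in `event_ratio_assembly` on opaque variables)
  have hbox := ChartGauss.le_setIntegral_smallField_exp (H := H) (t := s / 2) hβp ht0 hC₃pos hvar
  have hZppos := ChartGauss.integral_exp_neg_mul_boxQuadForm_pos (H := H) hβp
  have hZratio := ChartGauss.integral_exp_neg_mul_boxQuadForm_eq_mul (H := H) hβp hβm
  have hρNpos : 0 < Real.sqrt (β * (1 + ε) / (β * (1 - ε))) ^ Fintype.card (LandauFree H × Fin 3) :=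
    pow_pos (Real.sqrt_pos.2 (div_pos hβp hβm)) _
  -- the Gaussian hypothesis at `β(1 ± ε) ∈ [β/2, 2β]`
  have hlo_p : β / 2 ≤ β * (1 + ε) := by
    have h := mul_le_mul_of_nonneg_left (show (1 : ℝ) / 2 ≤ 1 + ε by linarith only [hε0]) hβpos.le
    linarith only [h]
  have hhi_p : β * (1 + ε) ≤ 2 * β := by
    have h := mul_le_mul_of_nonneg_left (show 1 + ε ≤ (2 : ℝ) by linarith only [hε1]) hβpos.le
    linarith only [h]
  have hlo_m : β / 2 ≤ β * (1 - ε) := by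
    have h := mul_le_mul_of_nonneg_left (show (1 : ℝ) / 2 ≤ 1 - ε by linarith only [hεle]) hβpos.le
    linarith only [h]
  have hhi_m : β * (1 - ε) ≤ 2 * β := by
    have h := mul_le_mul_of_nonneg_left (show 1 - ε ≤ (2 : ℝ) by linarith only [hε0]) hβpos.le
    linarith only [h]
  have hAp_le := setIntegral_gaussWeight_le_of_gaussAvg_le hβp hA (hgauss _ hlo_p hhi_p)
  have hAm_le := setIntegral_gaussWeight_le_of_gaussAvg_le hβm hA (hgauss _ hlo_m hhi_m)
  have hAm0 : 0 ≤ ∫ a in A, Real.exp (-(β * (1 - ε) * boxQuadForm H a)) :=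
    setIntegral_nonneg hA fun a _ => (Real.exp_pos _).le
  -- the mass ratio exponent: `√((1+ε)/(1−ε))^{3n} ≤ e^{6nε}`
  have hρN : Real.sqrt (β * (1 + ε) / (β * (1 - ε))) ^ Fintype.card (LandauFree H × Fin 3) ≤
      Real.exp (6 * (Fintype.card (LandauFree H) : ℝ) * (C₆p * s * H)) := by
    have h1 : Real.sqrt (β * (1 + ε) / (β * (1 - ε))) ≤ Real.exp (2 * ε) := by
      rw [mul_div_mul_left _ _ hβpos.ne']
      exact sqrt_ratio_le_exp hε0 hεle
    have hN : (Fintype.card (LandauFree H × Fin 3) : ℝ) = 3 * (Fintype.card (LandauFree H) : ℝ) := by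
      rw [Fintype.card_prod, Fintype.card_fin]; push_cast; ring
    calc Real.sqrt (β * (1 + ε) / (β * (1 - ε))) ^ Fintype.card (LandauFree H × Fin 3)
        ≤ Real.exp (2 * ε) ^ Fintype.card (LandauFree H × Fin 3) := pow_le_pow_left₀ (Real.sqrt_nonneg _) h1 _
      _ = Real.exp (6 * (Fintype.card (LandauFree H) : ℝ) * (C₆p * s * H)) := by
          rw [← Real.exp_nat_mul, hN, hεdef]; ring_nf
  -- the denominator keeps three quarters of the Gaussian mass
  have h288 : 288 * C₃ ≤ C := by rw [hCdef]; linarith only [hC₆p0, hC₇p0]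
  have hquarter := six_card_exp_le_quarter hH hβpos.le hε0 hC₃pos h288 hlog hCβ
  -- the bracket
  have hbr := (mul_le_mul_of_nonneg_right (mul_le_mul_of_nonneg_right hρN (sq_nonneg K)) (Real.exp_pos _).le).trans
    (event_bracket_le hH (card_landauFree_le hH) hs.le hs1 hC₆p0 hC₃pos.le)
  -- assemble (pure arithmetic on opaque variables)
  have hmain := event_ratio_assembly hK hD₀ (by positivity) hZppos hρNpos hU hL hAm_le hAm0 hAp_le hZratio hbox hquarter hp4 hbr
  refine ⟨hmain, hmain.trans ?_⟩
  -- the weaker reference set `smallField s ∖ A ⊇ smallField (s/2) ∖ A`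
  have hp0 : 0 ≤ p := by
    refine le_trans ?_ (hgauss β (by linarith only [hβpos]) (by linarith only [hβpos]))
    unfold gaussAvg
    refine div_nonneg (integral_nonneg fun a => mul_nonneg (Set.indicator_nonneg (fun _ _ => zero_le_one) _) ?_)
      (integral_nonneg fun a => ?_)
    · unfold gaussWeight; exact (Real.exp_pos _).le
    · unfold gaussWeight; exact (Real.exp_pos _).le
  have hwi : IntegrableOn (fpChartWeight β H r) (smallField H s \ A) :=
    (integrableOn_fpChartWeight_smallField hH hβpos.le hε1 hK.le hD₀ hsand (fun a ha => (hdet a ha).1) r hs.le le_rfl).mono_set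
      Set.sdiff_subset
  have hsub : smallField H (s / 2) \ A ⊆ smallField H s \ A := fun a ha => ⟨fun e => (ha.1 e).trans htT, ha.2⟩
  have hmono : ∫ a in smallField H (s / 2) \ A, fpChartWeight β H r a ≤ ∫ a in smallField H s \ A, fpChartWeight β H r a :=
    setIntegral_mono_set hwi (ae_of_all _ fun a => FPChart.fpChartWeight_nonneg β r a) (ae_of_all _ hsub)
  exact mul_le_mul_of_nonneg_left hmono (mul_nonneg (by positivity) hp0)

/-- ★★ **`EventInsideFP`** (U5-BLOCKERS L4, generalised «CubicCutInsideFP») — inside the Faddeev–Popov chart weight, a cut of the small field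
`D = smallField H s` by ANY measurable event `A` with chart-Gaussian probability `gaussAvg β′ H 1_A ≤ p ≤ 1/4` for `β′ ∈ [β/2, 2β]` costs at most
`∫_{D ∩ A} w_J ≤ 2·e^{C·s·H⁵}·p·∫_{D ∖ A} w_J` (`w_J = fpChartWeight β H r`; `H ≥ 1`, `β > 0`, `0 < s ≤ r`, `s·H² ≤ c₀`, `C(1+log H) ≤ βs²`). -/
theorem eventInsideFP :
    ∃ C c₀ : ℝ, 0 < c₀ ∧ ∀ H : ℕ, 1 ≤ H → ∀ β r s : ℝ, 0 < β → 0 < s → s ≤ r → s * (H : ℝ) ^ 2 ≤ c₀ →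
      C * (1 + Real.log H) ≤ β * s ^ 2 →
      ∀ A : Set (LandauFree H → E3), MeasurableSet A → ∀ p : ℝ, p ≤ 1 / 4 →
        (∀ β' : ℝ, β / 2 ≤ β' → β' ≤ 2 * β → gaussAvg β' H (A.indicator fun _ => (1 : ℝ)) ≤ p) →
        ∫ a in smallField H s ∩ A, fpChartWeight β H r a ≤
          2 * Real.exp (C * s * (H : ℝ) ^ 5) * p * ∫ a in smallField H s \ A, fpChartWeight β H r a := by
  obtain ⟨C, c₀, hc₀, h⟩ := eventInsideFP_both
  exact ⟨C, c₀, hc₀, fun H hH β r s hβ hs hsr hsH hCβ A hA p hp hg => (h H hH β r s hβ hs hsr hsH hCβ A hA p hp hg).2⟩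

/-- ★ **`EventInsideFP`, sharper reference set** `smallField(s/2) ∖ A` (the T-S5.6-style form). -/
theorem eventInsideFP_half :
    ∃ C c₀ : ℝ, 0 < c₀ ∧ ∀ H : ℕ, 1 ≤ H → ∀ β r s : ℝ, 0 < β → 0 < s → s ≤ r → s * (H : ℝ) ^ 2 ≤ c₀ →
      C * (1 + Real.log H) ≤ β * s ^ 2 →
      ∀ A : Set (LandauFree H → E3), MeasurableSet A → ∀ p : ℝ, p ≤ 1 / 4 →
        (∀ β' : ℝ, β / 2 ≤ β' → β' ≤ 2 * β → gaussAvg β' H (A.indicator fun _ => (1 : ℝ)) ≤ p) →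
        ∫ a in smallField H s ∩ A, fpChartWeight β H r a ≤
          2 * Real.exp (C * s * (H : ℝ) ^ 5) * p * ∫ a in smallField H (s / 2) \ A, fpChartWeight β H r a := by
  obtain ⟨C, c₀, hc₀, h⟩ := eventInsideFP_both
  exact ⟨C, c₀, hc₀, fun H hH β r s hβ hs hsr hsH hCβ A hA p hp hg => (h H hH β r s hβ hs hsr hsH hCβ A hA p hp hg).1⟩

end SmallFieldFP

end Summit.QuantumFields.YangMills.Theorems.AllWindowsColdBoxBoxHighLine
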